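import Summits.Ventures.CertifiedArithmetic.LowPrec.GemmThetaE4M3Defs

/-!
# θ-certificate of E4M3²→bfloat16: the global tables, kernel-checked

HONEST FRAMING (venture CertifiedArithmetic / cell `pub-lowprec`, seat gemm, gen 8): certified error
envelopes and provably optimal rounding/accumulation schemes for low-precision formats under stated
cost models; every table by two implementations; no hardware or vendor claims.

Paper `gemm.tex` §Regimes Prop. Θ(i), instance E4M3·E4M3→`bfloat16`: the letter-independent part of the
compressed certificate of `GemmThetaE4M3Defs.lean`, by `decide +kernel` — the absorption windows of all
`2 · 4865` signed states (`statesOK`: two roundings each), the window chains (`winChainOK 1`, `2`), the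
value/potential chain (`monoChainOK`), the start checks of the 2011 letters, the two saturation
witnesses at `±2^44`, and the list sizes.  Used by `GemmThetaE4M3Sound.lean`.
-/

namespace Literature.ComputerArithmetic.FloatingPoint

namespace MiniFloat

namespace ThetaE4M3

/-- Windows of the states `0..1199`. [cell certificate, kernel-checked] -/
theorem states_ok_0 : statesOK 0 1200 = true := by
  decide +kernel

/-- Windows of the states `1200..2399`. [cell certificate, kernel-checked] -/
theorem states_ok_1 : statesOK 1200 1200 = true := by
  decide +kernel

/-- Windows of the states `2400..3599`. [cell certificate, kernel-checked] -/
theorem states_ok_2 : statesOK 2400 1200 = true := by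
  decide +kernel

/-- Windows of the states `3600..4864`. [cell certificate, kernel-checked] -/
theorem states_ok_3 : statesOK 3600 1265 = true := by
  decide +kernel

/-- The window chains with step `1` (absorbed runs). [cell certificate, kernel-checked] -/
theorem winChain_one : winChainOK 1 4865 = true := by
  decide +kernel

/-- The window chains with step `2` (parity classes). [cell certificate, kernel-checked] -/
theorem winChain_two : winChainOK 2 4865 = true := by
  decide +kernel

/-- `valG` strictly increasing, `Φ` nondecreasing along the indices. [cell certificate, kernel-checked] -/
theorem monoChain_ok : monoChainOK = true := by
  decide +kernel

/-- Every letter passes `startOK`. [cell certificate, kernel-checked] -/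
theorem starts_ok : lamG.all startOK = true := by
  decide +kernel

/-- There are `2011` letters. [cell] -/
theorem length_lamG : lamG.length = 2011 := by
  decide +kernel

/-- Saturation witness: the top state absorbs the largest letter upward. [cell, kernel-checked] -/
theorem rne8_top_add : rne8 (17592186044416 + 52613349376) = 17592186044416 := by
  decide +kernel

/-- Saturation witness, negative side. [cell, kernel-checked] -/
theorem rne8_bot_sub : rne8 (-17592186044416 - 52613349376) = -17592186044416 := by
  decide +kernel

end ThetaE4M3

end MiniFloat

end Literature.ComputerArithmetic.FloatingPoint
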